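import Summits.CriticalPhenomena.PercolationContinuityZ3.Theorems.PercNearOneGluingNoHeavyLowerTailCovTauA2
import HarnessLib

/-!
# The (A2) functionals for EDGE-cluster functionals

The files `…CovTauA2Defs/Star/Push/A2/Anti.lean` prove the two-source inequality (A2)
(modulo the one-source bounds) for functionals `Ψ(C_x)` of the VERTEX cluster.  The
final step `CovTau.covTau_of_diagonal` (`…CovTauAssembly.lean`) and the one-source lemma
`CovTauStarN.starN_ED` are phrased for monotone functionals `g(C_x)` of van den
Berg–Häggström–Kahn's open EDGE cluster (`rC U x ω = openEdgeCluster (ω ∩ edgesIn U) x`), a strictly larger class.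
THIS FILE and its two companions (`…CovTauA2Edge.lean`, `…CovTauA2EdgeAnti.lean`) redo the `Ψ`-dependent part for
that class — `CovTau.tfE`, `CovTau.BfE = Cov_{G[U]}(g(C_x), 1{v ∈ C_x})`, `CovTau.YfE`, `CovTau.XfE` and their
elementary properties and star decompositions; everything functional-independent (`sC`, `rest`, `Ef`, `Mf`, `qf`, `cf`,
`setStep_sum`, `sum_weight_rS`, `sum_cond_sC`) is reused.
[cite: VandenbergHaggstromKahn2005, Thm. 1.1 (pp. 3–5), §1 p. 3 (`C_s`)] [cite: KozmaNitzan2024, Conj. 1 (p. 3)]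
-/

noncomputable section

namespace Summit.CriticalPhenomena.PercolationContinuityZ3.Theorems.CovTau

open Literature.Probability.Percolation
open Literature.Probability.Percolation.BHK2006
open Literature.Probability.Percolation.DecisionTree (ind ind_of_mem ind_of_not_mem ind_nonneg)
open scoped Classical

variable {V : Type*} [Fintype V]

/-! ### The functionals for an edge-cluster functional `g` -/

/-- `t = E_{G[U]} g(C_x)` (`t_W` with `U = V ∖ W`). [folklore] -/
def tfE (w : Sym2 V → ℝ) (U : Finset V) (x : V) (g : Set (Sym2 V) → ℝ) : ℝ :=
  ∑ ω, weight w ω * g (rC U x ω)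

/-- `B = Cov_{G[U]}(g(C_x), 1{v ∈ C_x})` (`B(W)` with `U = V ∖ W`; normalised weights).
[cite: VandenbergHaggstromKahn2005, §1 p. 6 (Harris' inequality)] -/
def BfE (w : Sym2 V → ℝ) (U : Finset V) (x v : V) (g : Set (Sym2 V) → ℝ) : ℝ :=
  (∑ ω, weight w ω * (g (rC U x ω) *
      ind {ω : Set (Sym2 V) | (openGraph (ω ∩ edgesIn U)).Reachable x v} ω)) - tfE w U x g * cf w U x v

/-- `Y(N) = E[ B(C_N) ; x ∉ C_N ]` with `B(W)` the covariance in the world `G[U ∖ W]`.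
[cite: VandenbergHaggstromKahn2005, §1 p. 4] -/
def YfE (w : Sym2 V → ℝ) (U : Finset V) (x v : V) (g : Set (Sym2 V) → ℝ) (N : Set V) : ℝ :=
  ∑ ω, weight w ω * (BfE w (rest U N ω) x v g * ind (rD U x N) ω)

/-- `X(N) = E[ q(C_N)·B(C_N) ; x ∉ C_N ]`. [cite: VandenbergHaggstromKahn2005, §1 p. 4] -/
def XfE (w : Sym2 V → ℝ) (U : Finset V) (x o v : V) (g : Set (Sym2 V) → ℝ) (N : Set V) : ℝ :=
  ∑ ω, weight w ω * (qf w (rest U N ω) x o v * BfE w (rest U N ω) x v g * ind (rD U x N) ω)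

/-! ### Elementary properties -/

section Props

variable {w : Sym2 V → ℝ} (hw0 : ∀ e, 0 ≤ w e) (hw1 : ∀ e, w e ≤ 1)
include hw0 hw1

/-- **`B ≥ 0` (Harris)**: `g(C_x)` and `1{v ∈ C_x}` are increasing, so positively correlated under the product
weight (normalised: `Σ weight = 1`). [cite: VandenbergHaggstromKahn2005, §1 p. 6 (Harris' inequality)] -/
theorem BfE_nonneg (hm : ∑ ω, weight w ω = 1) (U : Finset V) (x v : V) {g : Set (Sym2 V) → ℝ}
    (hg : Monotone g) (hg0 : ∀ C, 0 ≤ g C) : 0 ≤ BfE w U x v g := by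
  have h := harris hw0 hw1 (f := fun ω => g (rC U x ω))
    (g := ind {ω : Set (Sym2 V) | (openGraph (ω ∩ edgesIn U)).Reachable x v})
    (fun _ => hg0 _) (fun _ => ind_nonneg _ _) (fun a b hab => hg (rC_mono U x hab))
    (by
      intro a b hab
      by_cases ha : a ∈ {ω : Set (Sym2 V) | (openGraph (ω ∩ edgesIn U)).Reachable x v}
      · have hb : b ∈ {ω : Set (Sym2 V) | (openGraph (ω ∩ edgesIn U)).Reachable x v} :=
          Set.mem_setOf.2 ((Set.mem_setOf.1 ha).mono (openGraph_le (Set.inter_subset_inter_left _ hab)))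
        rw [ind_of_mem ha, ind_of_mem hb]
      · rw [ind_of_not_mem ha]; exact ind_nonneg _ _)
  rw [hm, one_mul] at h
  unfold BfE tfE cf
  linarith

/-- `Y(N) ≥ 0`. [folklore] -/
theorem YfE_nonneg (hm : ∑ ω, weight w ω = 1) (U : Finset V) (x v : V) {g : Set (Sym2 V) → ℝ}
    (hg : Monotone g) (hg0 : ∀ C, 0 ≤ g C) (N : Set V) : 0 ≤ YfE w U x v g N :=
  sum_ind_nonneg hw0 hw1 (fun _ => BfE_nonneg hw0 hw1 hm _ x v hg hg0) _

/-- `X(N) ≥ 0`. [folklore] -/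
theorem XfE_nonneg (hm : ∑ ω, weight w ω = 1) (U : Finset V) (x o v : V) {g : Set (Sym2 V) → ℝ}
    (hg : Monotone g) (hg0 : ∀ C, 0 ≤ g C) (N : Set V) : 0 ≤ XfE w U x o v g N :=
  sum_ind_nonneg hw0 hw1 (fun _ => mul_nonneg (qf_nonneg hw0 hw1 _ x o v) (BfE_nonneg hw0 hw1 hm _ x v hg hg0)) _

end Props

/-! ### Vanishing cases and the empty source set -/

/-- `Y(N) = 0` when `x ∈ N` (`x ∈ C_N` always). [folklore] -/
theorem YfE_eq_zero_of_mem (w : Sym2 V → ℝ) (U : Finset V) (x v : V) (g : Set (Sym2 V) → ℝ) {N : Set V}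
    (hx : x ∈ N) : YfE w U x v g N = 0 :=
  Finset.sum_eq_zero fun ω _ => by
    rw [rD_eq_empty hx, ind_of_not_mem (Set.notMem_empty ω)]; ring

/-- `X(N) = 0` when `x ∈ N`. [folklore] -/
theorem XfE_eq_zero_of_mem (w : Sym2 V → ℝ) (U : Finset V) (x o v : V) (g : Set (Sym2 V) → ℝ) {N : Set V}
    (hx : x ∈ N) : XfE w U x o v g N = 0 :=
  Finset.sum_eq_zero fun ω _ => by
    rw [rD_eq_empty hx, ind_of_not_mem (Set.notMem_empty ω)]; ring

/-- In a world not containing `v` (with `v ≠ x`) the covariance `B` vanishes: `C_x` cannot contain `v`.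
[folklore] -/
theorem BfE_eq_zero_of_not_mem (w : Sym2 V → ℝ) {U : Finset V} {x v : V} (hv : v ∉ U) (hvx : v ≠ x)
    (g : Set (Sym2 V) → ℝ) : BfE w U x v g = 0 := by
  unfold BfE tfE cf
  have h0 : ∀ ω : Set (Sym2 V), ind {ω : Set (Sym2 V) | (openGraph (ω ∩ edgesIn U)).Reachable x v} ω = 0 :=
    fun ω => ind_of_not_mem fun h => hv (SandwichBHK.mem_of_reachable h (Ne.symm hvx))
  simp only [h0, mul_zero, Finset.sum_const_zero]; ring

/-- With `v = x` the covariance `B` vanishes (normalised weights): `1{x ∈ C_x} = 1`. [folklore] -/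
theorem BfE_eq_zero_of_eq (w : Sym2 V → ℝ) (hm : ∑ ω, weight w ω = 1) (U : Finset V) (x : V)
    (g : Set (Sym2 V) → ℝ) : BfE w U x x g = 0 := by
  unfold BfE tfE cf
  have h1 : ∀ ω : Set (Sym2 V), ind {ω : Set (Sym2 V) | (openGraph (ω ∩ edgesIn U)).Reachable x x} ω = 1 :=
    fun ω => ind_of_mem (SimpleGraph.Reachable.refl x)
  simp only [h1, mul_one, hm]; ring

/-- In a world not containing `x` (with `v ≠ x`) the covariance `B` vanishes: `C_x = {x}` cannot contain `v`.
[folklore] -/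
theorem BfE_eq_zero_of_not_mem_owner (w : Sym2 V → ℝ) {U : Finset V} {x v : V} (hx : x ∉ U) (hvx : v ≠ x)
    (g : Set (Sym2 V) → ℝ) : BfE w U x v g = 0 := by
  unfold BfE tfE cf
  have h0 : ∀ ω : Set (Sym2 V), ind {ω : Set (Sym2 V) | (openGraph (ω ∩ edgesIn U)).Reachable x v} ω = 0 :=
    fun ω => ind_of_not_mem fun h => hx (SandwichBHK.mem_of_reachable h.symm hvx)
  simp only [h0, mul_zero, Finset.sum_const_zero]; ring

/-- `Y(N) = 0` in `G[U]` when `v ∉ U` (and `v ≠ x`). [folklore] -/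
theorem YfE_eq_zero_of_not_mem (w : Sym2 V → ℝ) {U : Finset V} {x v : V} (hv : v ∉ U) (hvx : v ≠ x)
    (g : Set (Sym2 V) → ℝ) (N : Set V) : YfE w U x v g N = 0 :=
  Finset.sum_eq_zero fun ω _ => by
    rw [BfE_eq_zero_of_not_mem w (fun h' => hv (rest_subset U N ω h')) hvx]; ring

/-- `Y(N) = 0` in `G[U]` when `x ∉ U` (and `v ≠ x`). [folklore] -/
theorem YfE_eq_zero_of_not_mem_owner (w : Sym2 V → ℝ) {U : Finset V} {x v : V} (hx : x ∉ U) (hvx : v ≠ x)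
    (g : Set (Sym2 V) → ℝ) (N : Set V) : YfE w U x v g N = 0 :=
  Finset.sum_eq_zero fun ω _ => by
    rw [BfE_eq_zero_of_not_mem_owner w (fun h' => hx (rest_subset U N ω h')) hvx]; ring

/-- `X(∅) = q·B` (the cluster of the empty source set is empty). [folklore] -/
theorem XfE_empty (w : Sym2 V → ℝ) (hm : ∑ ω, weight w ω = 1) (U : Finset V) (x o v : V) (g : Set (Sym2 V) → ℝ) :
    XfE w U x o v g ∅ = qf w U x o v * BfE w U x v g := by
  unfold XfE
  have h : ∀ ω : Set (Sym2 V), ind (rD U x (∅ : Set V)) ω = 1 := fun ω => ind_of_mem fun _ h => h.elim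
  simp only [rest_empty, h, mul_one]
  rw [← Finset.sum_mul, hm, one_mul]

/-- `Y(∅) = B`. [folklore] -/
theorem YfE_empty (w : Sym2 V → ℝ) (hm : ∑ ω, weight w ω = 1) (U : Finset V) (x v : V) (g : Set (Sym2 V) → ℝ) :
    YfE w U x v g ∅ = BfE w U x v g := by
  unfold YfE
  have h : ∀ ω : Set (Sym2 V), ind (rD U x (∅ : Set V)) ω = 1 := fun ω => ind_of_mem fun _ h => h.elim
  simp only [rest_empty, h, mul_one]
  rw [← Finset.sum_mul, hm, one_mul]

/-! ### Star decompositions -/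

/-- Star decomposition of `Y`: `Y_U(N) = Σ_ω weight(ω) · Y_{U∖Z}((N ∖ Z) ∪ S(ω))` for `Z ⊆ N`, `x ∉ Z`.
[cite: VandenbergHaggstromKahn2005, §1 p. 4, identity (6)] -/
theorem YfE_step {U Z : Finset V} (hZU : Z ⊆ U) {x : V} (hx : x ∉ Z) {N : Set V} (hZN : (↑Z : Set V) ⊆ N)
    (w : Sym2 V → ℝ) (hm : ∑ ω, weight w ω = 1) (v : V) (g : Set (Sym2 V) → ℝ) :
    YfE w U x v g N = ∑ ω, weight w ω * YfE w (U \ Z) x v g ((N \ ↑Z) ∪ rS U Z ω) :=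
  setStep_sum hZU hx hZN w hm fun U' => BfE w U' x v g

/-- Star decomposition of `X`: `X_U(N) = Σ_ω weight(ω) · X_{U∖Z}((N ∖ Z) ∪ S(ω))` for `Z ⊆ N`, `x ∉ Z`.
[cite: VandenbergHaggstromKahn2005, §1 p. 4, identity (6)] -/
theorem XfE_step {U Z : Finset V} (hZU : Z ⊆ U) {x : V} (hx : x ∉ Z) {N : Set V} (hZN : (↑Z : Set V) ⊆ N)
    (w : Sym2 V → ℝ) (hm : ∑ ω, weight w ω = 1) (o v : V) (g : Set (Sym2 V) → ℝ) :
    XfE w U x o v g N = ∑ ω, weight w ω * XfE w (U \ Z) x o v g ((N \ ↑Z) ∪ rS U Z ω) :=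
  setStep_sum hZU hx hZN w hm fun U' => qf w U' x o v * BfE w U' x v g

end Summit.CriticalPhenomena.PercolationContinuityZ3.Theorems.CovTau
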